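import Summits.CriticalPhenomena.PercolationContinuityZ3.Theorems.PercNearOneGluingNoHeavyQuantFlowPieces
import Summits.CriticalPhenomena.PercolationContinuityZ3.Theorems.PercNearOneGluingNoHeavyQuantDECAtTMixtures
import Summits.CriticalPhenomena.PercolationContinuityZ3.Theorems.PercNearOneGluingNoHeavyQuantLawDecUsageMongeRates
import Summits.CriticalPhenomena.PercolationContinuityZ3.Theorems.PercNearOneGluingNoHeavyQuantLawDecFlowsDecomposition
import Summits.CriticalPhenomena.PercolationContinuityZ3.Theorems.PercNearOneGluingNoHeavyQuantFlowUncross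
import Summits.CriticalPhenomena.PercolationContinuityZ3.Theorems.PercNearOneGluingNoHeavyQuantSDEC
import HarnessLib

/-!
# QUANT lane R8, T-DEC, ROUTE 2: four-atom laws with a zero atom — bookkeeping, and the EASY layers of the admissibility
# characterisation (below `b`, at and above `c`, and the giant-only mid layers)

builds on p205010 (kernel theorem, internal audit signed; external expert review pending)

Support file (`--supports stmt-CriticalPhenomena-4575`), QUANT lane, seat prim-quant-arm-2 (gen 37), rung R8 of
`run/shared/lean/prim/quant/LADDER.md`; first kernel piece of the proof that the Route-2 gate cell `LawDec.AD3GateTriple4`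
(typer g31) holds.  Memo `run/shared/lean/prim/quant/prim-quant-arm-2-g37/AD3-GATE4-G37.md`.  Theorems only, standard axioms,
no sorries, no definitions.  Continued in `…QuantAD3FourAtomFlows` (the corner layers and the by-regime assembly — see there for
the statement of the characterisation and the evidence).

THE SETTING.  A law `L = QD[a, b, c, Z, A, B, C]` on four atoms `0 < a < b < c ≤ M` with masses `Z, A, B, C ≥ 0`
(`Z + A + B + C = 1`), mean `T = aA + bB + cC`, floor `0 < y < 1`.
* `LawDec.sum_mul_QD`, `QD_facts`, `QD_laws`, `gate_QD` — bookkeeping (`gate` only changes the masses).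
* `LawDec.fourAtom_decAt_of_flow` — a flow at the mean gives `DECAt` (`decAtT_of_flowAtT`).
* `LawDec.fourAtom_decAt_below` — layers `j′ < b`: the lows `0`, `a` ride the giants `b, c` iff H1 `y ≤ B + C` (`flowAtT_of_giants`).
* `LawDec.fourAtom_decAt_top` — layers `c ≤ j′`: Theorem A (`decAt_of_top_le` with top `c`, `y·c ≤ T`; `decAtT_mono_top`).
* `LawDec.fourAtom_decAt_mid_threeLows` — layers `b ≤ j′ < c` from H2 `y ≤ C` (everything rides the giant `c`).
* `LawDec.fourAtom_decAt_mid_incompatible` — layers `b ≤ j′ < c` from H3 `y(Z + A) ≤ (1−y)C` when `T ≤ 2b` (`b` self-sufficient).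

[this work]; flow normal form / criterion E / Theorem A: this lane (typer g22–g26, lead g21–g22, census-2 g50).  The gluing rows served
[cite: KozmaNitzan2024, Conjecture 3 (p. 15)]; product measure [cite: Grimmett1999, §1.3 p. 10].
-/

noncomputable section

namespace Summit.CriticalPhenomena.PercolationContinuityZ3.Theorems

namespace Quant

open Finset

/-- four-atom law notation `QD[a, b, c, Z, A, B, C, h] = Z·[h = 0] + A·[h = a] + B·[h = b] + C·[h = c]`. -/
local notation3 "QD[" a ", " b ", " c ", " Z ", " A ", " B ", " C ", " h "]" =>
  (Z : ℝ) * (if (h : ℕ) = (0 : ℕ) then (1 : ℝ) else 0) + (A : ℝ) * (if (h : ℕ) = (a : ℕ) then (1 : ℝ) else 0)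
    + (B : ℝ) * (if (h : ℕ) = (b : ℕ) then (1 : ℝ) else 0) + (C : ℝ) * (if (h : ℕ) = (c : ℕ) then (1 : ℝ) else 0)

namespace LawDec

/-! ### Bookkeeping for four-atom laws -/

/-- `Σ_{h ∈ s} f h · QD h` for distinct atoms `0 < a < b < c`: the four charged values. [folklore] -/
theorem sum_mul_QD (s : Finset ℕ) (f : ℕ → ℝ) (a b c : ℕ) (Z A B C : ℝ) :
    ∑ h ∈ s, f h * QD[a, b, c, Z, A, B, C, h]
      = (if 0 ∈ s then f 0 * Z else 0) + (if a ∈ s then f a * A else 0) + (if b ∈ s then f b * B else 0)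
        + (if c ∈ s then f c * C else 0) := by
  have e : ∀ h : ℕ, f h * QD[a, b, c, Z, A, B, C, h]
      = (if h = 0 then f h * Z else 0) + (if h = a then f h * A else 0) + (if h = b then f h * B else 0)
        + (if h = c then f h * C else 0) := by
    intro h
    split_ifs <;> ring
  simp_rw [e]
  rw [Finset.sum_add_distrib, Finset.sum_add_distrib, Finset.sum_add_distrib, Finset.sum_ite_eq' s 0,
    Finset.sum_ite_eq' s a, Finset.sum_ite_eq' s b, Finset.sum_ite_eq' s c]

/-- facts of a four-atom mass vector on `{0..M}` (`0 < a < b < c ≤ M`, nonnegative masses): nonnegative, vanishing above `M`,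
total mass `Z + A + B + C`, first moment `aA + bB + cC`. [folklore] -/
theorem QD_facts (M a b c : ℕ) (Z A B C : ℝ) (ha : 0 < a) (hab : a < b) (hbc : b < c) (hcM : c ≤ M)
    (hZ : 0 ≤ Z) (hA : 0 ≤ A) (hB : 0 ≤ B) (hC : 0 ≤ C) :
    (∀ h, 0 ≤ QD[a, b, c, Z, A, B, C, h]) ∧ (∀ h, M < h → QD[a, b, c, Z, A, B, C, h] = 0) ∧
      (∑ h ∈ Finset.range (M + 1), QD[a, b, c, Z, A, B, C, h] = Z + A + B + C) ∧
      (∑ h ∈ Finset.range (M + 1), (h : ℝ) * QD[a, b, c, Z, A, B, C, h] = (a : ℝ) * A + (b : ℝ) * B + (c : ℝ) * C) := by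
  refine ⟨fun h => ?_, fun h hh => ?_, ?_, ?_⟩
  · refine add_nonneg (add_nonneg (add_nonneg ?_ ?_) ?_) ?_ <;>
      exact mul_nonneg (by assumption) (by split_ifs <;> norm_num)
  · rw [if_neg (by omega), if_neg (by omega), if_neg (by omega), if_neg (by omega)]; ring
  · have := sum_mul_QD (Finset.range (M + 1)) (fun _ => (1 : ℝ)) a b c Z A B C
    simp only [one_mul] at this
    rw [this, if_pos (Finset.mem_range.2 (by omega)), if_pos (Finset.mem_range.2 (by omega)),
      if_pos (Finset.mem_range.2 (by omega)), if_pos (Finset.mem_range.2 (by omega))]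
  · rw [sum_mul_QD (Finset.range (M + 1)) (fun h => (h : ℝ)) a b c Z A B C,
      if_pos (Finset.mem_range.2 (by omega)), if_pos (Finset.mem_range.2 (by omega)),
      if_pos (Finset.mem_range.2 (by omega)), if_pos (Finset.mem_range.2 (by omega))]
    push_cast
    ring

/-- law facts of a four-atom law on `{0..M}` (`0 < a < b < c ≤ M`, nonnegative masses summing to `1`): nonnegative, vanishing
above `M`, mass `1`, mean `aA + bB + cC`. [folklore] -/
theorem QD_laws (M a b c : ℕ) (Z A B C : ℝ) (ha : 0 < a) (hab : a < b) (hbc : b < c) (hcM : c ≤ M)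
    (hZ : 0 ≤ Z) (hA : 0 ≤ A) (hB : 0 ≤ B) (hC : 0 ≤ C) (hsum : Z + A + B + C = 1) :
    (∀ h, 0 ≤ QD[a, b, c, Z, A, B, C, h]) ∧ (∀ h, M < h → QD[a, b, c, Z, A, B, C, h] = 0) ∧
      (∑ h ∈ Finset.range (M + 1), QD[a, b, c, Z, A, B, C, h] = 1) ∧
      (∑ h ∈ Finset.range (M + 1), (h : ℝ) * QD[a, b, c, Z, A, B, C, h] = (a : ℝ) * A + (b : ℝ) * B + (c : ℝ) * C) := by
  obtain ⟨h0, hM, hs, hm⟩ := QD_facts M a b c Z A B C ha hab hbc hcM hZ hA hB hC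
  exact ⟨h0, hM, by rw [hs, hsum], hm⟩

/-- the gate of a four-atom law is the four-atom law with masses `(1 − q + qZ, qA, qB, qC)`. [this work] -/
theorem gate_QD (a b c : ℕ) (Z A B C q : ℝ) :
    gate (fun h => QD[a, b, c, Z, A, B, C, h]) q = fun h => QD[a, b, c, 1 - q + q * Z, q * A, q * B, q * C, h] := by
  funext h
  simp only [gate]
  split_ifs <;> ring

/-- from a flow at the mean to `DECAt` for a four-atom law. [this work] -/
theorem fourAtom_decAt_of_flow (y : ℝ) (j' M a b c : ℕ) (Z A B C : ℝ) (ha : 0 < a) (hab : a < b) (hbc : b < c)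
    (hcM : c ≤ M) (hZ : 0 ≤ Z) (hA : 0 ≤ A) (hB : 0 ≤ B) (hC : 0 ≤ C) (hsum : Z + A + B + C = 1) (hy0 : 0 < y) (hy1 : y < 1)
    (hF : FlowAtT y ((a : ℝ) * A + (b : ℝ) * B + (c : ℝ) * C) j' M (fun h => QD[a, b, c, Z, A, B, C, h])) :
    DECAt y j' M (fun h => QD[a, b, c, Z, A, B, C, h]) := by
  obtain ⟨_, hLM, hL1, hmean⟩ := QD_laws M a b c Z A B C ha hab hbc hcM hZ hA hB hC hsum
  rw [decAt_iff_decAtT, hmean]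
  exact decAtT_of_flowAtT y _ j' M _ hy0 hy1 hLM hL1 hF

/-! ### Layers below `b`: lows among `0, a`, giants `b, c` -/

/-- **layers `j′ < b`** (H1: `y ≤ B + C`): every low (`0`, and `a` when `a ≤ j′`, `2a < T`) rides the giants `b, c`. [this work] -/
theorem fourAtom_decAt_below (y : ℝ) (j' M a b c : ℕ) (Z A B C : ℝ) (ha : 0 < a) (hab : a < b) (hbc : b < c)
    (hcM : c ≤ M) (hZ : 0 ≤ Z) (hA : 0 ≤ A) (hB : 0 ≤ B) (hC : 0 ≤ C) (hsum : Z + A + B + C = 1) (hy0 : 0 < y) (hy1 : y < 1)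
    (hjb : j' < b) (hH1 : y ≤ B + C) :
    DECAt y j' M (fun h => QD[a, b, c, Z, A, B, C, h]) := by
  obtain ⟨hL0, -, -, -⟩ := QD_laws M a b c Z A B C ha hab hbc hcM hZ hA hB hC hsum
  refine fourAtom_decAt_of_flow y j' M a b c Z A B C ha hab hbc hcM hZ hA hB hC hsum hy0 hy1
    (flowAtT_of_giants y _ j' M _ hy0 hy1 hL0 ?_)
  set T : ℝ := (a : ℝ) * A + (b : ℝ) * B + (c : ℝ) * C with hT
  have h1y : 0 < 1 - y := by linarith
  -- the low mass is at most `Z + A`, the giant mass is at least `B + C`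
  have hlow : ∑ l ∈ Finset.range (j' + 1), (if 2 * (l : ℝ) < T then QD[a, b, c, Z, A, B, C, l] else 0)
      ≤ Z + (if a ≤ j' then A else 0) := by
    have e : ∀ l : ℕ, (if 2 * (l : ℝ) < T then QD[a, b, c, Z, A, B, C, l] else 0)
        = (if 2 * (l : ℝ) < T then (1 : ℝ) else 0) * QD[a, b, c, Z, A, B, C, l] := by
      intro l; split_ifs <;> ring
    simp_rw [e]
    rw [sum_mul_QD _ _ a b c Z A B C, if_pos (show (0 : ℕ) ∈ Finset.range (j' + 1) from Finset.mem_range.2 (Nat.succ_pos j')),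
      if_neg (show b ∉ Finset.range (j' + 1) by rw [Finset.mem_range]; omega),
      if_neg (show c ∉ Finset.range (j' + 1) by rw [Finset.mem_range]; omega), add_zero, add_zero]
    refine add_le_add ?_ ?_
    · split_ifs <;> linarith
    · by_cases haj : a ≤ j'
      · rw [if_pos (show a ∈ Finset.range (j' + 1) from Finset.mem_range.2 (by omega)), if_pos haj]; split_ifs <;> linarith
      · rw [if_neg (show a ∉ Finset.range (j' + 1) by rw [Finset.mem_range]; omega), if_neg haj]
  have hgiant : (if a ≤ j' then (0 : ℝ) else A) + B + C ≤ ∑ h ∈ Finset.Ico (j' + 1) (M + 1), QD[a, b, c, Z, A, B, C, h] := by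
    have := sum_mul_QD (Finset.Ico (j' + 1) (M + 1)) (fun _ => (1 : ℝ)) a b c Z A B C
    simp only [one_mul] at this
    rw [this, if_neg (show (0 : ℕ) ∉ Finset.Ico (j' + 1) (M + 1) by simp),
      if_pos (show b ∈ Finset.Ico (j' + 1) (M + 1) from Finset.mem_Ico.2 ⟨by omega, by omega⟩),
      if_pos (show c ∈ Finset.Ico (j' + 1) (M + 1) from Finset.mem_Ico.2 ⟨by omega, by omega⟩), zero_add]
    by_cases haj : a ≤ j'
    · rw [if_pos haj, if_neg (show a ∉ Finset.Ico (j' + 1) (M + 1) by rw [Finset.mem_Ico]; omega)]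
    · rw [if_neg haj, if_pos (show a ∈ Finset.Ico (j' + 1) (M + 1) from Finset.mem_Ico.2 ⟨by omega, by omega⟩)]
  have hux : 0 < y / (1 - y) := div_pos hy0 h1y
  have key : y / (1 - y) * (Z + (if a ≤ j' then A else 0)) ≤ (if a ≤ j' then (0 : ℝ) else A) + B + C := by
    rw [div_mul_eq_mul_div, div_le_iff₀ h1y]
    by_cases haj : a ≤ j'
    · rw [if_pos haj, if_pos haj]; nlinarith
    · rw [if_neg haj, if_neg haj]; nlinarith
  calc y / (1 - y) * ∑ l ∈ Finset.range (j' + 1), (if 2 * (l : ℝ) < T then QD[a, b, c, Z, A, B, C, l] else 0)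
      ≤ y / (1 - y) * (Z + (if a ≤ j' then A else 0)) := mul_le_mul_of_nonneg_left hlow hux.le
    _ ≤ (if a ≤ j' then (0 : ℝ) else A) + B + C := key
    _ ≤ _ := hgiant

/-! ### Layers at and above `c`: Theorem A -/

/-- **layers `c ≤ j′`**: every atom is at or below the layer and affordable (`y·c ≤ T`), so Theorem A (`decAt_of_top_le` with top
`c`, then `decAtT_mono_top`) applies. [this work] -/
theorem fourAtom_decAt_top (y : ℝ) (j' M a b c : ℕ) (Z A B C : ℝ) (ha : 0 < a) (hab : a < b) (hbc : b < c)
    (hcM : c ≤ M) (hZ : 0 ≤ Z) (hA : 0 ≤ A) (hB : 0 ≤ B) (hC : 0 ≤ C) (hsum : Z + A + B + C = 1) (hy1 : y < 1)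
    (hta : y * (c : ℝ) ≤ (a : ℝ) * A + (b : ℝ) * B + (c : ℝ) * C) (hcj : c ≤ j') :
    DECAt y j' M (fun h => QD[a, b, c, Z, A, B, C, h]) := by
  obtain ⟨hL0, hLc, hL1c, hmeanc⟩ := QD_laws c a b c Z A B C ha hab hbc le_rfl hZ hA hB hC hsum
  obtain ⟨-, -, -, hmeanM⟩ := QD_laws M a b c Z A B C ha hab hbc hcM hZ hA hB hC hsum
  have hy0' : ∀ h : ℕ, 0 < QD[a, b, c, Z, A, B, C, h] →
      y * (h : ℝ) ≤ ∑ k ∈ Finset.range (c + 1), (k : ℝ) * QD[a, b, c, Z, A, B, C, k] := by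
    intro h hh
    rw [hmeanc]
    have hhc : h ≤ c := by
      by_contra hlt
      exact absurd (hLc h (not_le.1 hlt)) (ne_of_gt hh)
    by_cases hy : 0 ≤ y
    · have : y * (h : ℝ) ≤ y * (c : ℝ) := mul_le_mul_of_nonneg_left (by exact_mod_cast hhc) hy
      linarith
    · have : y * (h : ℝ) ≤ 0 := mul_nonpos_of_nonpos_of_nonneg (le_of_not_ge hy) (Nat.cast_nonneg h)
      have hT0 : 0 ≤ (a : ℝ) * A + (b : ℝ) * B + (c : ℝ) * C := by positivity
      linarith
  have h1 := decAt_of_top_le c _ hL0 hLc hL1c y hy1 hy0' j' hcj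
  rw [decAt_iff_decAtT, hmeanc] at h1
  rw [decAt_iff_decAtT, hmeanM]
  exact decAtT_mono_top h1 hcM

/-! ### Layers `b ≤ j′ < c`: the giant `c`, the mid `b` -/

/-- **regime (i), three lows** (`2b < T`, H2: `y ≤ C`): `0, a, b` ride the giant `c`. [this work] -/
theorem fourAtom_decAt_mid_threeLows (y : ℝ) (j' M a b c : ℕ) (Z A B C : ℝ) (ha : 0 < a) (hab : a < b) (hbc : b < c)
    (hcM : c ≤ M) (hZ : 0 ≤ Z) (hA : 0 ≤ A) (hB : 0 ≤ B) (hC : 0 ≤ C) (hsum : Z + A + B + C = 1) (hy0 : 0 < y) (hy1 : y < 1)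
    (hbj : b ≤ j') (hjc : j' < c) (hH2 : y ≤ C) :
    DECAt y j' M (fun h => QD[a, b, c, Z, A, B, C, h]) := by
  obtain ⟨hL0, -, -, -⟩ := QD_laws M a b c Z A B C ha hab hbc hcM hZ hA hB hC hsum
  refine fourAtom_decAt_of_flow y j' M a b c Z A B C ha hab hbc hcM hZ hA hB hC hsum hy0 hy1
    (flowAtT_of_giants y _ j' M _ hy0 hy1 hL0 ?_)
  set T : ℝ := (a : ℝ) * A + (b : ℝ) * B + (c : ℝ) * C with hT
  have h1y : 0 < 1 - y := by linarith
  have hlow : ∑ l ∈ Finset.range (j' + 1), (if 2 * (l : ℝ) < T then QD[a, b, c, Z, A, B, C, l] else 0) ≤ Z + A + B := by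
    have e : ∀ l : ℕ, (if 2 * (l : ℝ) < T then QD[a, b, c, Z, A, B, C, l] else 0)
        = (if 2 * (l : ℝ) < T then (1 : ℝ) else 0) * QD[a, b, c, Z, A, B, C, l] := by
      intro l; split_ifs <;> ring
    simp_rw [e]
    rw [sum_mul_QD _ _ a b c Z A B C, if_pos (show (0 : ℕ) ∈ Finset.range (j' + 1) from Finset.mem_range.2 (Nat.succ_pos j')),
      if_pos (show a ∈ Finset.range (j' + 1) from Finset.mem_range.2 (by omega)),
      if_pos (show b ∈ Finset.range (j' + 1) from Finset.mem_range.2 (by omega)),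
      if_neg (show c ∉ Finset.range (j' + 1) by rw [Finset.mem_range]; omega), add_zero]
    refine add_le_add (add_le_add ?_ ?_) ?_ <;> split_ifs <;> linarith
  have hgiant : C ≤ ∑ h ∈ Finset.Ico (j' + 1) (M + 1), QD[a, b, c, Z, A, B, C, h] := by
    have := sum_mul_QD (Finset.Ico (j' + 1) (M + 1)) (fun _ => (1 : ℝ)) a b c Z A B C
    simp only [one_mul] at this
    rw [this, if_neg (show (0 : ℕ) ∉ Finset.Ico (j' + 1) (M + 1) by simp),
      if_neg (show a ∉ Finset.Ico (j' + 1) (M + 1) by rw [Finset.mem_Ico]; omega),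
      if_neg (show b ∉ Finset.Ico (j' + 1) (M + 1) by rw [Finset.mem_Ico]; omega),
      if_pos (show c ∈ Finset.Ico (j' + 1) (M + 1) from Finset.mem_Ico.2 ⟨by omega, by omega⟩)]
    linarith
  have hux : 0 < y / (1 - y) := div_pos hy0 h1y
  have key : y / (1 - y) * (Z + A + B) ≤ C := by
    rw [div_mul_eq_mul_div, div_le_iff₀ h1y]; nlinarith
  calc y / (1 - y) * ∑ l ∈ Finset.range (j' + 1), (if 2 * (l : ℝ) < T then QD[a, b, c, Z, A, B, C, l] else 0)
      ≤ y / (1 - y) * (Z + A + B) := mul_le_mul_of_nonneg_left hlow hux.le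
    _ ≤ C := key
    _ ≤ _ := hgiant

/-- **regime (ii), `b` self-sufficient** (`T ≤ 2b`, H3: `y(Z + A) ≤ (1−y)C`): the lows `0, a` ride the giant `c` (whether or
not `b` could help). [this work] -/
theorem fourAtom_decAt_mid_incompatible (y : ℝ) (j' M a b c : ℕ) (Z A B C : ℝ) (ha : 0 < a) (hab : a < b) (hbc : b < c)
    (hcM : c ≤ M) (hZ : 0 ≤ Z) (hA : 0 ≤ A) (hB : 0 ≤ B) (hC : 0 ≤ C) (hsum : Z + A + B + C = 1) (hy0 : 0 < y) (hy1 : y < 1)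
    (hbj : b ≤ j') (hjc : j' < c) (h2b : (a : ℝ) * A + (b : ℝ) * B + (c : ℝ) * C ≤ 2 * (b : ℝ))
    (hH3 : y * (Z + A) ≤ (1 - y) * C) :
    DECAt y j' M (fun h => QD[a, b, c, Z, A, B, C, h]) := by
  obtain ⟨hL0, -, -, -⟩ := QD_laws M a b c Z A B C ha hab hbc hcM hZ hA hB hC hsum
  refine fourAtom_decAt_of_flow y j' M a b c Z A B C ha hab hbc hcM hZ hA hB hC hsum hy0 hy1
    (flowAtT_of_giants y _ j' M _ hy0 hy1 hL0 ?_)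
  set T : ℝ := (a : ℝ) * A + (b : ℝ) * B + (c : ℝ) * C with hT
  have h1y : 0 < 1 - y := by linarith
  have hlow : ∑ l ∈ Finset.range (j' + 1), (if 2 * (l : ℝ) < T then QD[a, b, c, Z, A, B, C, l] else 0) ≤ Z + A := by
    have e : ∀ l : ℕ, (if 2 * (l : ℝ) < T then QD[a, b, c, Z, A, B, C, l] else 0)
        = (if 2 * (l : ℝ) < T then (1 : ℝ) else 0) * QD[a, b, c, Z, A, B, C, l] := by
      intro l; split_ifs <;> ring
    simp_rw [e]
    rw [sum_mul_QD _ _ a b c Z A B C, if_pos (show (0 : ℕ) ∈ Finset.range (j' + 1) from Finset.mem_range.2 (Nat.succ_pos j')),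
      if_pos (show a ∈ Finset.range (j' + 1) from Finset.mem_range.2 (by omega)),
      if_pos (show b ∈ Finset.range (j' + 1) from Finset.mem_range.2 (by omega)),
      if_neg (show c ∉ Finset.range (j' + 1) by rw [Finset.mem_range]; omega), add_zero,
      if_neg (show ¬ (2 * ((b : ℕ) : ℝ) < T) by linarith), zero_mul, add_zero]
    refine add_le_add ?_ ?_ <;> split_ifs <;> linarith
  have hgiant : C ≤ ∑ h ∈ Finset.Ico (j' + 1) (M + 1), QD[a, b, c, Z, A, B, C, h] := by
    have := sum_mul_QD (Finset.Ico (j' + 1) (M + 1)) (fun _ => (1 : ℝ)) a b c Z A B C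
    simp only [one_mul] at this
    rw [this, if_neg (show (0 : ℕ) ∉ Finset.Ico (j' + 1) (M + 1) by simp),
      if_neg (show a ∉ Finset.Ico (j' + 1) (M + 1) by rw [Finset.mem_Ico]; omega),
      if_neg (show b ∉ Finset.Ico (j' + 1) (M + 1) by rw [Finset.mem_Ico]; omega),
      if_pos (show c ∈ Finset.Ico (j' + 1) (M + 1) from Finset.mem_Ico.2 ⟨by omega, by omega⟩)]
    linarith
  have hux : 0 < y / (1 - y) := div_pos hy0 h1y
  have key : y / (1 - y) * (Z + A) ≤ C := by
    rw [div_mul_eq_mul_div, div_le_iff₀ h1y]; nlinarith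
  calc y / (1 - y) * ∑ l ∈ Finset.range (j' + 1), (if 2 * (l : ℝ) < T then QD[a, b, c, Z, A, B, C, l] else 0)
      ≤ y / (1 - y) * (Z + A) := mul_le_mul_of_nonneg_left hlow hux.le
    _ ≤ C := key
    _ ≤ _ := hgiant

end LawDec

end Quant

end Summit.CriticalPhenomena.PercolationContinuityZ3.Theorems
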